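import Mathlib
import Summits.ValiantsHypothesis.ValiantsHypothesis.Theorems.NewtonUnitEquationsTwoProductsCollinear
/-! # Stub `stub_levelCount` — crux `TwoProducts` (stmt-ValiantsHypothesis-5906), line `corner-log-linearization`
   Pure support geometry, no products: for any bivariate polynomial `D` and any nonzero
   `ℓ ∈ ℕ²`, each level line `ℓ 0 * q 0 + ℓ 1 * q 1 = m` of `supp D` carries at most two
   south-west vertices (strict minimisers over `supp D` of an integer weight with both entries
   positive), so the number of south-west vertices is at most twice the number of levels met by
   the support.  A positive level is a genuine line with normal `ν = ℓ` and is handled by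
   `TwoProducts.Collinear.no_three_sw_on_level`; the level `m = 0` lies on a coordinate axis
   (one coordinate vanishes identically) and carries at most one vertex. [folklore] -/
set_option linter.dupNamespace false -- single-conjunct summit: `ValiantsHypothesis.ValiantsHypothesis`
namespace Summit.ValiantsHypothesis.ValiantsHypothesis.Theorems.TwoProducts.LevelCount
open scoped BigOperators
open MvPolynomial
open Summit.ValiantsHypothesis.ValiantsHypothesis.Theorems.TwoProducts.Collinear

/-- Level zero carries at most one south-west vertex: two distinct points `a ≠ b` of `ℕ²` with
`ℓ 0 * q 0 + ℓ 1 * q 1 = 0` for a nonzero `ℓ ∈ ℕ²` share a vanishing coordinate, so each being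
strictly lighter than the other for some weight with positive entries is absurd. [folklore] -/
theorem no_two_sw_on_level_zero (S : Finset (Fin 2 →₀ ℕ)) (ℓ : Fin 2 → ℕ) (hℓ : ℓ ≠ 0)
    (a b : Fin 2 →₀ ℕ) (hab : a ≠ b)
    (hla : ℓ 0 * a 0 + ℓ 1 * a 1 = 0) (hlb : ℓ 0 * b 0 + ℓ 1 * b 1 = 0)
    (hswa : ∃ w : Fin 2 → ℤ, 0 < w 0 ∧ 0 < w 1 ∧ (a ∈ S ∧ ∀ e' ∈ S, e' ≠ a →
      w 0 * (a 0 : ℤ) + w 1 * (a 1 : ℤ) < w 0 * (e' 0 : ℤ) + w 1 * (e' 1 : ℤ)))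
    (hswb : ∃ w : Fin 2 → ℤ, 0 < w 0 ∧ 0 < w 1 ∧ (b ∈ S ∧ ∀ e' ∈ S, e' ≠ b →
      w 0 * (b 0 : ℤ) + w 1 * (b 1 : ℤ) < w 0 * (e' 0 : ℤ) + w 1 * (e' 1 : ℤ))) : False := by
  obtain ⟨w, hw0, hw1, haS, hmina⟩ := hswa
  obtain ⟨w', hw0', hw1', hbS, hminb⟩ := hswb
  have h1 := hmina b hbS hab.symm
  have h2 := hminb a haS hab
  have ha0 : ℓ 0 * a 0 = 0 := Nat.eq_zero_of_add_eq_zero_right hla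
  have ha1 : ℓ 1 * a 1 = 0 := Nat.eq_zero_of_add_eq_zero_left hla
  have hb0 : ℓ 0 * b 0 = 0 := Nat.eq_zero_of_add_eq_zero_right hlb
  have hb1 : ℓ 1 * b 1 = 0 := Nat.eq_zero_of_add_eq_zero_left hlb
  have hℓ' : ℓ 0 ≠ 0 ∨ ℓ 1 ≠ 0 := by
    by_contra h
    push Not at h
    apply hℓ
    funext i
    fin_cases i <;> simp [h.1, h.2]
  rcases hℓ' with hi | hi
  · have ea : a 0 = 0 := (mul_eq_zero.mp ha0).resolve_left hi
    have eb : b 0 = 0 := (mul_eq_zero.mp hb0).resolve_left hi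
    simp only [ea, eb, Nat.cast_zero, mul_zero, zero_add] at h1 h2
    exact lt_asymm (lt_of_mul_lt_mul_left h1 hw1.le) (lt_of_mul_lt_mul_left h2 hw1'.le)
  · have ea : a 1 = 0 := (mul_eq_zero.mp ha1).resolve_left hi
    have eb : b 1 = 0 := (mul_eq_zero.mp hb1).resolve_left hi
    simp only [ea, eb, Nat.cast_zero, mul_zero, add_zero] at h1 h2
    exact lt_asymm (lt_of_mul_lt_mul_left h1 hw0.le) (lt_of_mul_lt_mul_left h2 hw0'.le)

/-- STUB `stub_levelCount`: for any bivariate `D` and any nonzero `ℓ ∈ ℕ²`, the number of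
south-west vertices of `supp D` (strict minimisers of some integer weight with both entries
positive) is at most twice the number of values of `ℓ 0 * q 0 + ℓ 1 * q 1` on `supp D`: the
level map sends the (finite) vertex set into that image and every fibre has at most two elements
(`Collinear.no_three_sw_on_level` with normal `ν = ℓ` on a positive level,
`no_two_sw_on_level_zero` on level `0`). [folklore] -/
theorem stub_levelCount : ∀ (D : MvPolynomial (Fin 2) ℂ) (ℓ : Fin 2 → ℕ), ℓ ≠ 0 →
    {e : Fin 2 →₀ ℕ | ∃ w : Fin 2 → ℤ, 0 < w 0 ∧ 0 < w 1 ∧ e ∈ D.support ∧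
        ∀ e' ∈ D.support, e' ≠ e → w 0 * (e 0 : ℤ) + w 1 * (e 1 : ℤ) < w 0 * (e' 0 : ℤ) + w 1 * (e' 1 : ℤ)}.ncard
      ≤ 2 * (D.support.image fun q => ℓ 0 * q 0 + ℓ 1 * q 1).card := by
  intro D ℓ hℓ
  set S := D.support with hS
  set SW := {e : Fin 2 →₀ ℕ | ∃ w : Fin 2 → ℤ, 0 < w 0 ∧ 0 < w 1 ∧ e ∈ S ∧
      ∀ e' ∈ S, e' ≠ e → w 0 * (e 0 : ℤ) + w 1 * (e 1 : ℤ) < w 0 * (e' 0 : ℤ) + w 1 * (e' 1 : ℤ)}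
    with hSW
  have hsub : SW ⊆ ↑S := by
    rintro e ⟨w, -, -, he, -⟩
    exact he
  have hfin : SW.Finite := S.finite_toSet.subset hsub
  rw [Set.ncard_eq_toFinset_card SW hfin]
  set T := hfin.toFinset with hT
  have hmaps : ∀ e ∈ T, ℓ 0 * e 0 + ℓ 1 * e 1 ∈
      S.image (fun q : Fin 2 →₀ ℕ => ℓ 0 * q 0 + ℓ 1 * q 1) := fun e he =>
    Finset.mem_image_of_mem (fun q : Fin 2 →₀ ℕ => ℓ 0 * q 0 + ℓ 1 * q 1)
      (hsub (hfin.mem_toFinset.mp he))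
  have hfib : ∀ m ∈ S.image (fun q : Fin 2 →₀ ℕ => ℓ 0 * q 0 + ℓ 1 * q 1),
      (T.filter (fun e => ℓ 0 * e 0 + ℓ 1 * e 1 = m)).card ≤ 2 := by
    intro m _
    refine not_lt.mp fun h3 => ?_
    obtain ⟨a, ha, b, hb, c, hc, hab, hac, hbc⟩ := Finset.two_lt_card.mp h3
    rw [Finset.mem_filter] at ha hb hc
    rcases Nat.eq_zero_or_pos m with hm0 | hm
    · exact no_two_sw_on_level_zero S ℓ hℓ a b hab (ha.2.trans hm0) (hb.2.trans hm0)
        (hfin.mem_toFinset.mp ha.1) (hfin.mem_toFinset.mp hb.1)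
    · have hl0 : (m : ℤ) ≠ 0 := by exact_mod_cast hm.ne'
      have hla : (ℓ 0 : ℤ) * (a 0 : ℤ) + (ℓ 1 : ℤ) * (a 1 : ℤ) = m := by exact_mod_cast ha.2
      have hlb : (ℓ 0 : ℤ) * (b 0 : ℤ) + (ℓ 1 : ℤ) * (b 1 : ℤ) = m := by exact_mod_cast hb.2
      have hlc : (ℓ 0 : ℤ) * (c 0 : ℤ) + (ℓ 1 : ℤ) * (c 1 : ℤ) = m := by exact_mod_cast hc.2
      exact no_three_sw_on_level S (fun i => (ℓ i : ℤ)) (m : ℤ) hl0 a b c hab hac hbc hla hlb hlc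
        (hfin.mem_toFinset.mp ha.1) (hfin.mem_toFinset.mp hb.1) (hfin.mem_toFinset.mp hc.1)
  exact Finset.card_le_mul_card_image_of_maps_to hmaps 2 hfib

end Summit.ValiantsHypothesis.ValiantsHypothesis.Theorems.TwoProducts.LevelCount
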